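import Summits.Ventures.PercRepro.GenQHyperplaneRowsA

/-!
# PercRepro — the hyperplane-trace block of the profile LP, as rows (night-4, gen 8; part B: the pencil cap (P0))

Two distinct rank-`(r + 1)` flats meet in a flat of rank `≤ r`; if every flat of rank `≤ r` has `≤ B` points and
`2s > |G| + B`, at most ONE rank-`(r + 1)` flat has an `s`-point trace on `G` (`hypTr_le_one`) — the row (P0) of the
hyperplane block.  The flat bounds of the core below rank `6` / `5` (`flat_bound_le_five` / `flat_bound_le_four`:
`B = 21` / `10`) come from `hs` / `hline` / `hplane` / `hsolid` / `hflat5`; a flat of rank `≤ 1` of a simple matroid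
has at most one point (`card_le_one_of_flatsQ_le_one`).  `Type*` copies of `GenQPencil`'s `Type`-only
`isFlat_inter_of_isFlat` / `inter_mem_flatsQ_of_ne` (primed names) keep the universe of the certificate modules.
-/
namespace PercRepro.Night4

open Finset ThmH SixFour GenQ PerFlat Star

variable {α : Type*} [DecidableEq α] {M : Matroid α} [M.Finite]

omit [DecidableEq α] [M.Finite] in
/-- The intersection of two flats is a flat (`Type*` copy of `GenQPencil.isFlat_inter_of_isFlat`, which is stated for `Type`). -/
theorem isFlat_inter_of_isFlat' {F F' : Set α} (hF : M.IsFlat F) (hF' : M.IsFlat F') : M.IsFlat (F ∩ F') := by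
  have h := Matroid.IsFlat.iInter (M := M) (Fs := fun b : Bool => if b then F else F')
    (fun b => by cases b <;> simpa)
  convert h using 1
  ext x
  simp only [Set.mem_inter_iff, Set.mem_iInter, Bool.forall_bool, Bool.false_eq_true, if_false, if_true]
  exact and_comm

omit [DecidableEq α] [M.Finite] in
/-- Every finset has a natural rank. -/
theorem exists_eRk_eq_nat' (X : Finset α) : ∃ k : ℕ, M.eRk (X : Set α) = k := by
  have h := M.eRk_le_encard (X : Set α)
  rw [Set.encard_coe_eq_coe_finsetCard] at h
  obtain ⟨k, hk⟩ := ENat.ne_top_iff_exists.1 (ne_top_of_le_ne_top (ENat.coe_ne_top _) h)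
  exact ⟨k, hk.symm⟩

/-- Two distinct rank-`(r+1)` flats meet in a flat of rank `≤ r` (`Type*` copy of `GenQPencil.inter_mem_flatsQ_of_ne`). -/
theorem inter_mem_flatsQ_of_ne' {r : ℕ} {F F' : Finset α} (hF : F ∈ flatsQ M (r + 1)) (hF' : F' ∈ flatsQ M (r + 1))
    (hne : F ≠ F') : ∃ a, F ∩ F' ∈ flatsQ M a ∧ a ≤ r := by
  have hF1 := mem_flatsQ.1 hF
  have hF1' := mem_flatsQ.1 hF'
  obtain ⟨a, ha⟩ := exists_eRk_eq_nat' (M := M) (F ∩ F')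
  have hK : F ∩ F' ∈ flatsQ M a := by
    rw [mem_flatsQ]
    refine ⟨Finset.inter_subset_left.trans hF1.1, ?_, ha⟩
    rw [Finset.coe_inter]
    exact isFlat_inter_of_isFlat' hF1.2.1 hF1'.2.1
  refine ⟨a, hK, ?_⟩
  have hle : (a : ℕ∞) ≤ ((r + 1 : ℕ) : ℕ∞) := by
    rw [← ha, ← hF1.2.2]
    exact M.eRk_mono (Finset.coe_subset.2 Finset.inter_subset_left)
  have hle' : a ≤ r + 1 := by exact_mod_cast hle
  by_contra h
  have ha' : a = r + 1 := by omega
  have hK' := mem_flatsQ.1 hK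
  have hclF : M.closure ((F ∩ F' : Finset α) : Set α) = M.closure (F : Set α) :=
    (M.isRkFinite_of_finite (Finset.finite_toSet (F ∩ F'))).closure_eq_closure_of_subset_of_eRk_ge_eRk
      (Finset.coe_subset.2 Finset.inter_subset_left) (by rw [hK'.2.2, hF1.2.2, ha'])
  have hclF' : M.closure ((F ∩ F' : Finset α) : Set α) = M.closure (F' : Set α) :=
    (M.isRkFinite_of_finite (Finset.finite_toSet (F ∩ F'))).closure_eq_closure_of_subset_of_eRk_ge_eRk
      (Finset.coe_subset.2 Finset.inter_subset_right) (by rw [hK'.2.2, hF1'.2.2, ha'])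
  rw [hF1.2.1.closure] at hclF
  rw [hF1'.2.1.closure] at hclF'
  exact hne (Finset.coe_injective (hclF.symm.trans hclF'))

/-- A flat of rank `≤ 1` of a simple matroid has at most one point. -/
theorem card_le_one_of_flatsQ_le_one (hs : Simple M) {a : ℕ} (ha : a ≤ 1) {K : Finset α} (hK : K ∈ flatsQ M a) :
    K.card ≤ 1 := by
  have hK' := mem_flatsQ.1 hK
  rw [Finset.card_le_one]
  intro y hy z hz
  by_contra hne
  have hyE : y ∈ M.E := by
    have := hK'.1 hy
    simpa [gr] using this
  have hzE : z ∈ M.E := by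
    have := hK'.1 hz
    simpa [gr] using this
  have h2 := hs y hyE z hzE hne
  have hle : M.eRk ({y, z} : Set α) ≤ M.eRk (K : Set α) := by
    apply M.eRk_mono
    intro w hw
    simp only [Set.mem_insert_iff, Set.mem_singleton_iff] at hw
    rcases hw with rfl | rfl
    · exact_mod_cast hy
    · exact_mod_cast hz
  rw [h2, hK'.2.2] at hle
  have : (2 : ℕ) ≤ a := by exact_mod_cast hle
  omega

/-- **(P0) as an LP row**: if every flat of rank `≤ r` has `≤ B` points and `2s > |G| + B`, at most ONE rank-`(r+1)`
flat has an `s`-point trace on `G` (two would share `≥ 2s − |G| > B` points of `G` inside a flat of rank `≤ r`). -/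
theorem hypTr_le_one (G : Finset α) {r s B : ℕ} (hB : ∀ a, a ≤ r → ∀ K ∈ flatsQ M a, K.card ≤ B)
    (h : B + G.card < 2 * s) : hypTr M G (r + 1) s ≤ 1 := by
  unfold hypTr
  rw [Finset.card_le_one]
  intro H hH H' hH'
  by_contra hne
  have hH1 := Finset.mem_filter.1 hH
  have hH1' := Finset.mem_filter.1 hH'
  obtain ⟨a, hKa, har⟩ := inter_mem_flatsQ_of_ne' hH1.1 hH1'.1 hne
  have hcap := hB a har _ hKa
  -- the traces meet in `≥ 2s − |G|` points, all inside `H ∩ H'`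
  have hsub : (H ∩ G) ∩ (H' ∩ G) ⊆ H ∩ H' := by
    intro x hx
    simp only [Finset.mem_inter] at hx ⊢
    exact ⟨hx.1.1, hx.2.1⟩
  have hsub2 : (H ∩ G) ∪ (H' ∩ G) ⊆ G := by
    intro x hx
    simp only [Finset.mem_union, Finset.mem_inter] at hx
    rcases hx with hx | hx
    · exact hx.2
    · exact hx.2
  have h1 := Finset.card_union_add_card_inter (H ∩ G) (H' ∩ G)
  have h2 := Finset.card_le_card hsub2
  have h3 := Finset.card_le_card hsub
  rw [hH1.2.1, hH1'.2.1] at h1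
  omega

/-- The flat bounds of the core below rank `6`: every flat of rank `≤ 5` has `≤ 21` points. -/
theorem flat_bound_le_five (hs : Simple M) (hline : ∀ L ∈ flatsQ M 2, L.card ≤ 3) (hplane : ∀ P ∈ flatsQ M 3, P.card ≤ 6)
    (hsolid : ∀ F ∈ flatsQ M 4, F.card ≤ 10) (hflat5 : ∀ F ∈ flatsQ M 5, F.card ≤ 21) :
    ∀ a, a ≤ 5 → ∀ K ∈ flatsQ M a, K.card ≤ 21 := by
  intro a ha K hK
  rcases (show a = 0 ∨ a = 1 ∨ a = 2 ∨ a = 3 ∨ a = 4 ∨ a = 5 by omega) with h | h | h | h | h | h <;> subst h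
  · exact (card_le_one_of_flatsQ_le_one hs (by norm_num) hK).trans (by norm_num)
  · exact (card_le_one_of_flatsQ_le_one hs (by norm_num) hK).trans (by norm_num)
  · exact (hline K hK).trans (by norm_num)
  · exact (hplane K hK).trans (by norm_num)
  · exact (hsolid K hK).trans (by norm_num)
  · exact hflat5 K hK

/-- The flat bounds of the core below rank `5`: every flat of rank `≤ 4` has `≤ 10` points. -/
theorem flat_bound_le_four (hs : Simple M) (hline : ∀ L ∈ flatsQ M 2, L.card ≤ 3) (hplane : ∀ P ∈ flatsQ M 3, P.card ≤ 6)
    (hsolid : ∀ F ∈ flatsQ M 4, F.card ≤ 10) :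
    ∀ a, a ≤ 4 → ∀ K ∈ flatsQ M a, K.card ≤ 10 := by
  intro a ha K hK
  rcases (show a = 0 ∨ a = 1 ∨ a = 2 ∨ a = 3 ∨ a = 4 by omega) with h | h | h | h | h <;> subst h
  · exact (card_le_one_of_flatsQ_le_one hs (by norm_num) hK).trans (by norm_num)
  · exact (card_le_one_of_flatsQ_le_one hs (by norm_num) hK).trans (by norm_num)
  · exact (hline K hK).trans (by norm_num)
  · exact (hplane K hK).trans (by norm_num)
  · exact hsolid K hK

/-- **The branch row**: `h_s = 0` when every trace has fewer than `s` points (the branch «no hyperplane trace of size `≥ s`»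
of the case split on the largest trace). -/
theorem hypTr_eq_zero_of_trace_lt {G : Finset α} {r s : ℕ} (h : ∀ H ∈ flatsQ M r, (H ∩ G).card < s) :
    hypTr M G r s = 0 := by
  unfold hypTr flatsTr
  rw [Finset.card_eq_zero, Finset.filter_eq_empty_iff]
  intro H hH hc
  have := h H hH
  omega

/-- `SP_{s,j} = 0` when every trace has fewer than `s` points. -/
theorem spSum_eq_zero_of_trace_lt {G : Finset α} {r s : ℕ} (h : ∀ H ∈ flatsQ M r, (H ∩ G).card < s) (j : ℕ) :
    spSum M G r s j = 0 := by
  unfold spSum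
  have h0 : flatsTr M G r s = ∅ := by
    unfold flatsTr
    rw [Finset.filter_eq_empty_iff]
    intro H hH hc
    have := h H hH
    omega
  rw [h0]; rfl

end PercRepro.Night4
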